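import Summits.AnomalousDissipation.AnomalousDissipation.Theorems.MomentParityQuarticGateDefectCertificate
import Summits.AnomalousDissipation.AnomalousDissipation.Theorems.MomentParityQuarticGateSignLemma
import Summits.AnomalousDissipation.AnomalousDissipation.Theorems.QuarticGate.Negative.LevelCeiling

/-!
# Row certificate for `QuarticLadder.QuarticGate` (stmt-AnomalousDissipation-11464),
# line `dissipative-tower`, stub S3″ `stub_rowCertificate`

A DEFECT CERTIFICATE from vanishing cubic-Casimir rows. For a smooth force `f`, a viscosity `ν` and a
law `μ` on `H` with finite fourth moments whose row `∫ nsGeneratorPairing ν f u (∇p(u)) dμ` vanishes on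
every homogeneous cubic band observable `p` that is a Casimir of level-`N` Galerkin–Euler
(`{p, B_N} ≡ 0` on level-`N` fields), there are finitely many level-`N` fields `vₗ` and weights
`cₗ ≥ 0` with `row_μ(p₃) + Σₗ cₗ {p₃, B_N}(vₗ) = 0` for EVERY homogeneous cubic band test `p₃`.

This is the landed S3 `MomentParityQuarticGate.stub_defectCertificate`
(`…Theorems.MomentParityQuarticGateDefectCertificate`) with its two hypotheses changed: the sign lemma
is now the landed theorem `MomentParityQuarticGate.stub_signLemma`, and the "no cubic Casimir"
hypothesis is replaced by the vanishing of the row on cubic Casimirs.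

Structure of the proof (finite-dimensional convex duality, as in the template):

* `W :=` homogeneous cubic polynomials in the coordinates `(u, bᵢ)` of an orthonormal band basis `b`
  of `V_N` (`exists_bandBasis`); every band datum `(m, g, P)` is transported to `W` with the same
  differential field (`band_eq_sum_smul`, `pairing_band_eq_sum`, `polyGrad_transport`).
* The row `ψ(P) = ∫ ⟨F(u), ∇p(u)⟩ dμ` and the Euler derivatives `ev_v(P) = {p, B_N}(v)` are linear
  functionals on `W` (`exists_cubicRowFunctional`, `exists_eulerFunctional`).
* If `ev_v(P) ≥ 0` for all level-`N` `v` then (sign lemma) `ev_v(P) = 0` for all level-`N` `v`,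
  i.e. `P` is a cubic Casimir, so `ψ P = 0` BY HYPOTHESIS. Hence the abstract cone lemma
  `exists_conic_certificate` (`…DefectCone`) applies: `-ψ` is a finite conic combination of Euler
  derivatives (`exists_rowCertificate_coords`), which is the certificate.
-/

namespace Summit.AnomalousDissipation.AnomalousDissipation.Theorems.QuarticLadderQuarticGate

open MeasureTheory Filter
open scoped InnerProductSpace RealInnerProductSpace
open Literature.Analysis.FunctionSpaces Literature.Analysis.FluidPDE
open Summit.AnomalousDissipation.AnomalousDissipation.Theorems.QuarticGate.Negative
open Summit.AnomalousDissipation.AnomalousDissipation.Theorems.MomentParityQuarticGate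
open MvPolynomial

set_option linter.dupNamespace false

variable {N n : ℕ} {b : Fin n → UnitAddTorus (Fin 3) → EuclideanSpace ℝ (Fin 3)}

/-! ## The row certificate in coordinates -/

/-- **The row certificate in the coordinates of an orthonormal band basis.** Assume that the row
`P ↦ ∫ ⟨F(u), ∇p(u)⟩ dμ` vanishes on every homogeneous cubic band observable whose Galerkin–Euler
derivative vanishes on level-`N` fields (a cubic Casimir). Then for the finite law `μ` on `H` with
`∫ ‖u‖⁴ dμ < ∞` there are finitely many level-`N` fields `vₗ` and weights `cₗ ≥ 0` with
`∫ ⟨F(u), ∇p(u)⟩ dμ + Σₗ cₗ {p, B_N}(vₗ) = 0` for every homogeneous cubic `P` in the coordinates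
`(u, bᵢ)`. Proof: the abstract cone lemma `exists_conic_certificate` on the homogeneous cubics,
with `ev v` the Euler derivatives and `ψ` the row; a cubic whose Euler derivatives are all `≥ 0`
on level-`N` fields has vanishing Euler derivatives there (sign lemma `stub_signLemma`), i.e. is a
cubic Casimir, on which `ψ` vanishes by hypothesis. [folklore] -/
theorem exists_rowCertificate_coords
    (ν : ℝ) {f : UnitAddTorus (Fin 3) → EuclideanSpace ℝ (Fin 3)} (hf : Integrable f volume)
    (μ : Measure (Torus.energySpace (Fin 3))) [IsFiniteMeasure μ]
    (h4 : Integrable (fun u : Torus.energySpace (Fin 3) => ‖u‖ ^ 4) μ)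
    (hR : ∀ (m : ℕ) (g : Fin m → UnitAddTorus (Fin 3) → EuclideanSpace ℝ (Fin 3))
      (P : MvPolynomial (Fin m) ℝ), (∀ i, IsBandTest N (g i)) → P.IsHomogeneous 3 →
      (∀ u : Torus.energySpace (Fin 3), IsLevel N u →
        Torus.nsGeneratorPairing (d := Fin 3) 0 0 u (polyGrad g P u) = 0) →
      ∫ u, Torus.nsGeneratorPairing ν f u (polyGrad g P u) ∂μ = 0)
    (hb : ∀ i, IsBandTest N (b i))
    (hbo : ∀ i j, ∫ x, ⟪b i x, b j x⟫_ℝ = if i = j then (1 : ℝ) else 0) :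
    ∃ (M : ℕ) (v : Fin M → Torus.energySpace (Fin 3)) (c : Fin M → ℝ),
      (∀ l, IsLevel N (v l)) ∧ (∀ l, 0 ≤ c l) ∧
      ∀ P : MvPolynomial (Fin n) ℝ, P.IsHomogeneous 3 →
        ∫ u, Torus.nsGeneratorPairing ν f u (polyGrad b P u) ∂μ +
          ∑ l, c l * Torus.nsGeneratorPairing (d := Fin 3) 0 0 (v l) (polyGrad b P (v l)) = 0 := by
  classical
  haveI : FiniteDimensional ℝ ↥(homogeneousSubmodule (Fin n) ℝ 3) :=
    Module.Finite.iff_fg.mpr (homogeneousSubmodule_fg (Fin n) ℝ 3)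
  obtain ⟨ψ, hψ⟩ := exists_cubicRowFunctional hb hbo ν hf μ h4
  obtain ⟨ev, hev⟩ := exists_eulerFunctional (n := n) hb
  -- the hypothesis of the cone lemma: a cubic with nonnegative Euler derivatives is a Casimir,
  -- on which the row vanishes
  have key : ∀ P : ↥(homogeneousSubmodule (Fin n) ℝ 3),
      (∀ x : {v : Torus.energySpace (Fin 3) // IsLevel N v}, 0 ≤ ev x.1 P) →
      ψ P = 0 ∧ ∀ x : {v : Torus.energySpace (Fin 3) // IsLevel N v}, ev x.1 P = 0 := by
    intro P hP
    have hPh : P.1.IsHomogeneous 3 := P.2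
    have h0 : ∀ u : Torus.energySpace (Fin 3), IsLevel N u →
        Torus.nsGeneratorPairing (d := Fin 3) 0 0 u (polyGrad b P.1 u) = 0 :=
      stub_signLemma N n b P.1 hb fun u hu => by
        have h := hP ⟨u, hu⟩
        rw [hev] at h
        exact h
    refine ⟨?_, fun x => by rw [hev]; exact h0 x.1 x.2⟩
    rw [hψ]
    exact hR n b P.1 hb hPh h0
  obtain ⟨M, x, c, hc0, hcert⟩ := exists_conic_certificate
    (fun x : {v : Torus.energySpace (Fin 3) // IsLevel N v} => ev x.1) ψ key
  refine ⟨M, fun l => (x l).1, c, fun l => (x l).2, hc0, fun P hP => ?_⟩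
  have h := hcert ⟨P, hP⟩
  rw [hψ] at h
  simp_rw [hev] at h
  exact h

/-! ## S3″ — the row certificate for arbitrary band data -/

/-- **S3″ — DEFECT CERTIFICATE FROM VANISHING CASIMIR ROWS (no symmetry, no Casimir hypothesis).**
For a smooth force `f`, a level-`N` probability law `μ` with finite fourth moments whose row
`∫ nsGeneratorPairing ν f u (∇p(u)) dμ` vanishes on every homogeneous cubic band observable `p` that is
a Casimir of level-`N` Galerkin–Euler, there are finitely many level-`N` fields `vₗ` and weights
`cₗ ≥ 0` with `row_μ(p₃) + Σₗ cₗ {p₃,B_N}(vₗ) = 0` for EVERY homogeneous cubic band test `p₃` — the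
plain certificate shape consumed by the landed surgery S4 (`MomentParityQuarticGate.stub_surgery`).
Proof: expand the band tests in an orthonormal band basis `b` of `V_N` (`exists_bandBasis`,
`band_eq_sum_smul`, `pairing_band_eq_sum`), which transports `(g, P)` to `(b, P ∘ G)` with the same
differential field (`polyGrad_transport`) and keeps homogeneity (`isHomogeneous_bind₁_linear`); in
these coordinates the statement is `exists_rowCertificate_coords` (the sign lemma `stub_signLemma`
plus the abstract cone lemma `exists_conic_certificate`). The probability and a.e.-level hypotheses
are not used beyond finiteness of `μ`. [folklore] -/
theorem stub_rowCertificate :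
    ∀ (N : ℕ) (ν : ℝ) (f : UnitAddTorus (Fin 3) → EuclideanSpace ℝ (Fin 3)), Torus.IsSmooth f →
    ∀ μ : Measure (Torus.energySpace (Fin 3)), IsProbabilityMeasure μ → (∀ᵐ u ∂μ, IsLevel N u) →
    Integrable (fun u : Torus.energySpace (Fin 3) => ‖u‖ ^ 4) μ →
    (∀ (m : ℕ) (g : Fin m → UnitAddTorus (Fin 3) → EuclideanSpace ℝ (Fin 3))
      (P : MvPolynomial (Fin m) ℝ), (∀ i, IsBandTest N (g i)) → P.IsHomogeneous 3 →
      (∀ u : Torus.energySpace (Fin 3), IsLevel N u →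
        Torus.nsGeneratorPairing (d := Fin 3) 0 0 u (polyGrad g P u) = 0) →
      ∫ u, Torus.nsGeneratorPairing ν f u (polyGrad g P u) ∂μ = 0) →
    ∃ (M : ℕ) (v : Fin M → Torus.energySpace (Fin 3)) (c : Fin M → ℝ),
      (∀ l, IsLevel N (v l)) ∧ (∀ l, 0 ≤ c l) ∧
      ∀ (m : ℕ) (g : Fin m → UnitAddTorus (Fin 3) → EuclideanSpace ℝ (Fin 3))
        (P : MvPolynomial (Fin m) ℝ), (∀ i, IsBandTest N (g i)) → P.IsHomogeneous 3 →
        ∫ u, Torus.nsGeneratorPairing ν f u (polyGrad g P u) ∂μ +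
          ∑ l, c l * Torus.nsGeneratorPairing (d := Fin 3) 0 0 (v l) (polyGrad g P (v l)) = 0 := by
  intro N ν f hf μ hμ _hμl h4 hR
  obtain ⟨n, b, hb, hbo, hbs⟩ := exists_bandBasis N
  obtain ⟨M, v, c, hvl, hc0, hcert⟩ :=
    exists_rowCertificate_coords ν hf.integrable μ h4 hR hb hbo
  refine ⟨M, v, c, hvl, hc0, fun m g P hg hP => ?_⟩
  -- transport the datum `(g, P)` to the coordinates of `b`
  have hgb : ∀ (j : Fin m) (x : UnitAddTorus (Fin 3)),
      g j x = ∑ i, (∫ y, ⟪g j y, b i y⟫_ℝ) • b i x := fun j x => band_eq_sum_smul hbs (hg j) x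
  have hpair : ∀ (u : Torus.energySpace (Fin 3)) (j : Fin m),
      Torus.pairing u.1 (g j) = ∑ i, (∫ y, ⟪g j y, b i y⟫_ℝ) * Torus.pairing u.1 (b i) :=
    fun u j => pairing_band_eq_sum hb hbs (hg j) u
  have ht : ∀ u : Torus.energySpace (Fin 3), polyGrad g P u =
      polyGrad b (MvPolynomial.bind₁ (fun j => ∑ i, MvPolynomial.C (∫ y, ⟪g j y, b i y⟫_ℝ) *
        (MvPolynomial.X i : MvPolynomial (Fin n) ℝ)) P) u :=
    fun u => funext (polyGrad_transport (fun j i => ∫ y, ⟪g j y, b i y⟫_ℝ) hgb hpair P u)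
  have h := hcert _ (isHomogeneous_bind₁_linear (fun j i => ∫ y, ⟪g j y, b i y⟫_ℝ) hP)
  simp_rw [ht]
  exact h

end Summit.AnomalousDissipation.AnomalousDissipation.Theorems.QuarticLadderQuarticGate
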